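import Summits.KontsevichZagierPeriods.KontsevichZagierPeriods.Theses.ExponentCosets
import Summits.KontsevichZagierPeriods.KontsevichZagierPeriods.Theorems.MzvKernelInKZ.Negative.ScalingDivision
import Literature.NumberTheory.Transcendental.KZMellinFibres

/-!
# `CosetKernel` (stmt-KontsevichZagierPeriods-12834, route ExponentCosets, rank 3) — birth skeleton

Crux (verbatim the route decl `Summit.KontsevichZagierPeriods.KontsevichZagierPeriods.Theses.ExponentCosets.CosetKernel`):
CONJECTURE 1 OF KONTSEVICH–ZAGIER INSIDE ONE MELLIN FIBRE — for a family `g = (g_1,…,g_K) ⊂ ℚ[x_1..x_m]`,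
a coset representative `e₀ ∈ ℚ^K` and finitely many members `r_i = [ (0,1)^m ∩ {g > 0}, κ_i ∏ g_k^{e₀_k + ν_ik} ]`
(`ν_i ∈ ℤ^K`, `κ_i ∈ ℚ`), every `ℤ`-combination `∑ a_i [r_i]` of value `0` lies in `KZ.relations`.

Line `birth` = the route's OWN two-step attack on crux 3 ("(reduction) Laporta/contiguity reduction to
finitely many masters INSIDE the calculus … (rigidity) ℤ-independence of the master values of the fibre")
cut into exactly those two named pieces, stated over the Mellin-fibre vocabulary of
`Literature/NumberTheory/Transcendental/KZMellinFibres.lean` (`KZ.IsMellinMemberWith g e κ r`: `r` has domain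
`KZ.mellinBox g = (0,1)^m ∩ {g > 0}` and integrand `κ ∏ g_k^{e_k}` on it; the crux hypothesis is token for
token `KZ.IsFibreFamily g e₀ ν κ r`). A *member of the fibre* `(g, e₀)` is an `r` with
`KZ.IsMellinMemberWith g (e₀ + ν) κ r` for some `ν ∈ ℤ^K`, `κ ∈ ℚ`; a *move-basis* of the fibre is a finite
list of members `μ_1 … μ_s` which is MOVE-INDEPENDENT up to torsion (`∑ c_j [μ_j] ∈ KZ.relations ⇒ c = 0`)
and GENERATES the fibre up to isogeny (every member `r` has `N [r] ≡ ∑ b_j [μ_j] (mod KZ.relations)` for some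
integer `N ≠ 0`, `b ∈ ℤ^s`) — a `ℤ`-basis of `(fibre span ⧸ relations) ⊗ ℚ` made of masters.

* `stub_masterBasis` (REDUCTION — IBP/contiguity reduction terminates INSIDE the calculus): every fibre
  `(g, e₀)` has a move-basis of masters. Content: the subgroup of `P_KZ = FormalRep ⧸ relations` spanned by
  one fibre has finite rank — finitely many master integrals, and the reduction of every member to them is
  a chain of MOVES (the engine is the route's crux 4 `BoxIBPTransfer`: shift relations with radical
  certificates; at generic exponent the shift/IBP relations generate all `ℚ(s)`-relations and
  `#masters = |χ|`, BitounEtAl2018 Lemma 7 / Cor. 14 / Cor. 18, AomotoKita2011 Ch. 2, BelkaleBrosnan2003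
  Thm 1.8; move-independence of a MINIMAL generating list is then free). Why it might fail: a resonant
  (integer) fibre where the specialised `ℚ[s]`-relations lose rank and the missing reductions are not
  moves; a convergence wall that no admissible certificate crosses. NOT implied by the crux alone (the crux
  says nothing about finite generation) — it is implied by the summit plus de Rham finiteness of the value
  span, so it is consistent.
* `stub_basisRigidity` (RIGIDITY — ONE transcendence statement per fibre): the periods `μ_j.value` of a
  move-basis are linearly independent over `ℚ` (`LinearIndependent ℚ`). This is where the arithmetic
  lives: for the Beta family it is Rohrlich–Lang territory restricted to one coset (calibrated by the
  route's support `BetaCosetKZ`), in dimension one the Huber–Wüstholz range (HuberWustholz2022 Thm 9.10),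
  in general Grothendieck-period-conjecture strength for one twisted box motive. Why it might fail (= the
  crux's): a finite-monodromy / CM Gauss fibre with `E′/E ∈ ℚ̄` at a rational argument, or a resonant fibre,
  whose value relation is not realised by moves — then a move-basis is LONGER than the `ℚ`-dimension of
  the value span and rigidity fails for it (that fibre would be a counterexample to Conjecture 1).

Composition (sorry-free, 30 tactic lines): `cosetKernel_of_stubs : <stub₁-sig> → <stub₂-sig> → <crux, unfolded
verbatim>` — take the move-basis `μ` of the fibre of the given members (`stub_masterBasis`); reduce each
`r_i` to it and clear denominators with `P = ∏ N_i` (`exists_nsmul_sum_sub_sum_mem`, pure algebra: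
cofactors `∏_{i'≠i} N_{i'}` by `Finset.prod_erase_mul`), so `P • ∑ a_i [r_i] ≡ ∑ d_j [μ_j] (mod relations)`;
by SOUNDNESS of the calculus (`KZ.relations_le_ker_eval_holds`, tree theorem) the right side has value `0`,
so `d = 0` by `stub_basisRigidity` (`Fintype.linearIndependent_iff`); hence `P • ∑ a_i [r_i] ∈ relations`
and TORSION-FREENESS of `P_KZ` (`Summit.KontsevichZagierPeriods.MzvKernelInKZ.Negative.mem_relations_of_nsmul_mem`,
the tree theorem behind the route's closed support item `TorsionFree` stmt-3169) divides `P`.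
`CosetKernel_of : CosetKernel` feeds the two stubs in BY NAME (the theorem `#h21_check_skeleton` keys on;
the audit admits no inline `Prop` hypotheses, hence the two-theorem shape, as in
`Cruxes/BetaProductSector/Lines/birth.lean`). Both stubs are load-bearing: rigidity is asked only of a
basis, which only reduction provides; reduction alone leaves the value-zero basis combination undecided.

`lean check --json` (2026-08-17): rc 0, errors [], sorries 2 = stubs 2 (`stub_masterBasis`,
`stub_basisRigidity`), zero elsewhere — file audit: `CosetKernel_of` class proof-of-item (target
`…Theses.ExponentCosets.CosetKernel`, "NOT closed: axioms [sorryAx]"), `cosetKernel_of_stubs` and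
`exists_nsmul_sum_sub_sum_mem` closed = true, the two stubs closed = false.

BC3 probes (folder `bc/CosetKernel_probe1_stub_masterBasis.lean`, `bc/CosetKernel_probe1_stub_basisRigidity.lean`:
one tactic per example with `set_option maxHeartbeats 400000`, `example : (stub-sig) → T := by intro h; exact?` /
`simpa [T]` / `aesop`, `T ∈ {CosetKernel, KontsevichZagierPeriods}`; plus the combined
`first | exact? | simpa | simpa [T] | (unfold T; simpa) | aesop` form in `bc/CosetKernel_probe_*.lean`): rc 1 with
12/12 (+ 4/4 combined) examples FAILING — `exact?` "could not close the goal" (4×), `simpa [T]` "Tactic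
`assumption` failed" with the unfolded target left (4×), `aesop` "failed to prove the goal after exhaustive
search" (stub_masterBasis, 2×) / deterministic timeout at `whnf` (stub_basisRigidity, 2×); combined form:
heartbeat timeouts. No stub is cheaply the crux or the summit.

Disproof used: none on file (no `Cruxes/CosetKernel/Disproof.lean`, no `_false_without_` theorem, no landed
`Negative/` lemma, no dead lines, no crux ideas before this session; `ledger negatives` has one unrelated entry,
KinematicFormulas plane convexity). Refuter record honoured: the crux-attack verdicts (gen 1 + gen 2,
2026-08-15) find `CosetKernel` TARGET-EQUIVALENT as filed (sign fibres on a disconnected `mellinBox`;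
`cosetKernel_of_summit` sorry-free, `summit_of_cosetKernel` modulo `SignFibrePresentation`) and propose the
repair C′ = "`0 < g_k` on the open box, domain = box"; the route sits in the re-audit bin REPAIRABLE. This
skeleton neither restates nor weakens the crux; both stubs are stated fibre-by-fibre over
`KZ.IsMellinMemberWith`, so under the repair C′ they restrict verbatim to the connected fibres (replace
`KZ.mellinBox g` by the box with `g > 0` on it) and the composition is unchanged.
-/

set_option linter.dupNamespace false

noncomputable section

namespace Summit.KontsevichZagierPeriods.KontsevichZagierPeriods.Cruxes.CosetKernel.Birth

open Summit.KontsevichZagierPeriods.KontsevichZagierPeriods.Theses.ExponentCosets (CosetKernel)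
open Literature.NumberTheory.Transcendental

/-! ## The two stubs -/

/-- Stub 1 — REDUCTION TO A MOVE-BASIS OF MASTERS (the IBP / contiguity engine run to completion INSIDE
the calculus). For every family `g : Fin K → ℚ[x_1..x_m]` and coset representative `e₀ ∈ ℚ^K` there are
finitely many members `μ_1, …, μ_s` of the fibre `(g, e₀)` (each `μ_j = [mellinBox g, κ'_j ∏ g_k^{e₀_k + ν'_jk}]`)
which are (i) MOVE-INDEPENDENT up to torsion — `∑ c_j [μ_j] ∈ KZ.relations ⇒ c = 0` — and (ii) GENERATING up
to isogeny — every member `r` of the fibre satisfies `N [r] − ∑ b_j [μ_j] ∈ KZ.relations` for some integer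
`N ≠ 0` and `b ∈ ℤ^s`: a `ℤ`-basis of `(fibre span ⧸ KZ.relations) ⊗ ℚ` consisting of master integrals.
Why plausibly true: at generic exponent the twisted Mellin transform turns annihilators into shift
relations, the shift/IBP relations generate all `ℚ(s)`-linear relations and the number of masters is the
signed Euler characteristic (BitounEtAl2018 Lemma 7, Cor. 14, Cor. 18; AomotoKita2011 Ch. 2 finiteness of
twisted de Rham cohomology; BelkaleBrosnan2003 Thm 1.8: `∑ c_i(s) I(s+i) = 0`, `c_i ∈ ℚ[s]`); each shift
relation specialised at the rational fibre is one Newton–Leibniz move with a radical certificate (route crux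
4 `BoxIBPTransfer`), and a MINIMAL generating list is automatically move-independent. Consistency: implied
by the summit together with de Rham finiteness of the `ℚ`-span of the fibre's values. Why it might fail:
resonant (integer) fibres where `c_0(s₀) = 0` and the specialised relations lose rank, the missing
reductions not being moves; convergence walls no admissible certificate crosses. Size: L–XL (per family it
is a terminating Laporta reduction with certificates; uniformly it is the engine conjecture of the line).
[cite: BitounEtAl2018, §2.2 Lemma 7] [cite: AomotoKita2011, Ch. 2] [cite: BelkaleBrosnan2003, Thm 1.8]
[cite: KontsevichZagier2001, §1.2] -/
theorem stub_masterBasis :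
    ∀ (m K : ℕ) (g : Fin K → MvPolynomial (Fin m) ℚ) (e₀ : Fin K → ℚ),
      ∃ (s : ℕ) (μ : Fin s → KZ.IntegralRep m),
        (∀ j, ∃ (ν : Fin K → ℤ) (κ : ℚ), KZ.IsMellinMemberWith g (fun k => e₀ k + (ν k : ℚ)) κ (μ j)) ∧
        (∀ c : Fin s → ℤ, ∑ j, c j • KZ.of (μ j) ∈ KZ.relations → ∀ j, c j = 0) ∧
        (∀ (r : KZ.IntegralRep m) (ν : Fin K → ℤ) (κ : ℚ),
          KZ.IsMellinMemberWith g (fun k => e₀ k + (ν k : ℚ)) κ r →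
          ∃ N : ℕ, N ≠ 0 ∧ ∃ b : Fin s → ℤ,
            (N : ℤ) • KZ.of r - ∑ j, b j • KZ.of (μ j) ∈ KZ.relations) := by
  sorry

/-- Stub 2 — RIGIDITY: THE PERIODS OF A MOVE-BASIS ARE LINEARLY INDEPENDENT OVER `ℚ` (one transcendence
statement per fibre). If `μ_1, …, μ_s` are members of the fibre `(g, e₀)`, move-independent up to torsion and
generating the fibre up to isogeny modulo `KZ.relations` (a move-basis, as produced by `stub_masterBasis`),
then their values `μ_j.value = ∫_{mellinBox g} κ'_j ∏ g_k^{e₀_k + ν'_jk}` — the periods of ONE rank-one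
local system on the box relative to its faces, over one cycle — are `ℚ`-linearly independent. Why
plausibly true: it is exactly what Conjecture 1 predicts for the fibre once reduction is done (all
`ℚ`-linear relations among the fibre's periods are accounted for by moves); known ranges: the Beta family
(one coset: all values rational multiples of one `B(a,b)`, Rohrlich–Lang `T`-relations are moves — route
support `BetaCosetKZ`; transcendence by Schneider / Wolfart–Wüstholz), dimension-one fibres (linear relations
among 1-periods are classified, HuberWustholz2022 Thm 9.10), Baker for the logarithmic fibres. Why it might
fail (= the crux's own risk): a finite-monodromy (Schwarz-list) or CM Gauss fibre with `E′/E ∈ ℚ̄` at a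
rational argument (Wolfart1988), or a resonant integer fibre, whose value relation is realised by NO chain
of moves — then the move-basis is longer than the `ℚ`-dimension of the value span and the fibre is a
counterexample to Conjecture 1. Size: open-problem in general (Grothendieck-period-conjecture strength for
one twisted box motive); M for the Beta cosets, L in dimension one.
[cite: HuberWustholz2022, Thm 9.10] [cite: Wolfart1988] [cite: Waldschmidt2006] [cite: KontsevichZagier2001, §1.2 Conjecture 1] -/
theorem stub_basisRigidity :
    ∀ (m K s : ℕ) (g : Fin K → MvPolynomial (Fin m) ℚ) (e₀ : Fin K → ℚ) (μ : Fin s → KZ.IntegralRep m),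
      (∀ j, ∃ (ν : Fin K → ℤ) (κ : ℚ), KZ.IsMellinMemberWith g (fun k => e₀ k + (ν k : ℚ)) κ (μ j)) →
      (∀ c : Fin s → ℤ, ∑ j, c j • KZ.of (μ j) ∈ KZ.relations → ∀ j, c j = 0) →
      (∀ (r : KZ.IntegralRep m) (ν : Fin K → ℤ) (κ : ℚ),
        KZ.IsMellinMemberWith g (fun k => e₀ k + (ν k : ℚ)) κ r →
        ∃ N : ℕ, N ≠ 0 ∧ ∃ b : Fin s → ℤ,
          (N : ℤ) • KZ.of r - ∑ j, b j • KZ.of (μ j) ∈ KZ.relations) →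
      LinearIndependent ℚ (fun j => (μ j).value) := by
  sorry

/-! ## Glue (sorry-free) -/

/-- Common denominator and change of coefficients (pure algebra in an abelian group): if each `x i`
reduces, up to the integer multiple `N i ≠ 0`, to a `ℤ`-combination of the `y j` modulo the subgroup
`R`, then `(∏ N) • ∑ a i • x i` is congruent modulo `R` to a single `ℤ`-combination of the `y j`.
[folklore] -/
theorem exists_nsmul_sum_sub_sum_mem {V : Type*} [AddCommGroup V] (R : AddSubgroup V) {L s : ℕ}
    (x : Fin L → V) (y : Fin s → V) (a : Fin L → ℤ) (N : Fin L → ℕ) (b : Fin L → Fin s → ℤ)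
    (h : ∀ i, (N i : ℤ) • x i - ∑ j, b i j • y j ∈ R) :
    ∃ d : Fin s → ℤ, ((∏ i, N i : ℕ) : ℤ) • (∑ i, a i • x i) - ∑ j, d j • y j ∈ R := by
  classical
  have hM : ∀ i, (∏ i' ∈ Finset.univ.erase i, N i') * N i = ∏ i', N i' :=
    fun i => Finset.prod_erase_mul _ _ (Finset.mem_univ i)
  refine ⟨fun j => ∑ i, (a i * ((∏ i' ∈ Finset.univ.erase i, N i' : ℕ) : ℤ)) * b i j, ?_⟩
  have hmem : ∑ i, (a i * ((∏ i' ∈ Finset.univ.erase i, N i' : ℕ) : ℤ)) •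
      ((N i : ℤ) • x i - ∑ j, b i j • y j) ∈ R :=
    R.sum_mem fun i _ => R.zsmul_mem (h i) _
  have e : ((∏ i, N i : ℕ) : ℤ) • (∑ i, a i • x i) -
        ∑ j, (∑ i, (a i * ((∏ i' ∈ Finset.univ.erase i, N i' : ℕ) : ℤ)) * b i j) • y j
      = ∑ i, (a i * ((∏ i' ∈ Finset.univ.erase i, N i' : ℕ) : ℤ)) •
          ((N i : ℤ) • x i - ∑ j, b i j • y j) := by
    simp only [smul_sub, Finset.smul_sum, Finset.sum_sub_distrib, smul_smul, Finset.sum_smul]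
    congr 1
    · refine Finset.sum_congr rfl fun i _ => ?_
      congr 1
      rw [← hM i]
      push_cast
      ring
    · exact Finset.sum_comm
  rw [e]
  exact hmem

/-- The composition, arrow form: MASTER BASIS → BASIS RIGIDITY → the crux (UNFOLDED verbatim, so
that exactly one theorem of this file, `CosetKernel_of`, concludes the crux by name). Proof: reduce
every member of the given combination to the basis with a common denominator `P = ∏ N i`
(`exists_nsmul_sum_sub_sum_mem`); by soundness (`KZ.relations_le_ker_eval_holds`) the resulting
basis combination has value `0`, so its coefficients vanish by rigidity; hence `P • c ∈ KZ.relations`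
and torsion-freeness of `P_KZ` (`MzvKernelInKZ.Negative.mem_relations_of_nsmul_mem`, the tree proof
behind the route's support item `TorsionFree`) gives `c ∈ KZ.relations`.
[cite: KontsevichZagier2001, §1.2 Conjecture 1] -/
theorem cosetKernel_of_stubs
    (hB : ∀ (m K : ℕ) (g : Fin K → MvPolynomial (Fin m) ℚ) (e₀ : Fin K → ℚ),
      ∃ (s : ℕ) (μ : Fin s → KZ.IntegralRep m),
        (∀ j, ∃ (ν : Fin K → ℤ) (κ : ℚ), KZ.IsMellinMemberWith g (fun k => e₀ k + (ν k : ℚ)) κ (μ j)) ∧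
        (∀ c : Fin s → ℤ, ∑ j, c j • KZ.of (μ j) ∈ KZ.relations → ∀ j, c j = 0) ∧
        (∀ (r : KZ.IntegralRep m) (ν : Fin K → ℤ) (κ : ℚ),
          KZ.IsMellinMemberWith g (fun k => e₀ k + (ν k : ℚ)) κ r →
          ∃ N : ℕ, N ≠ 0 ∧ ∃ b : Fin s → ℤ,
            (N : ℤ) • KZ.of r - ∑ j, b j • KZ.of (μ j) ∈ KZ.relations))
    (hR : ∀ (m K s : ℕ) (g : Fin K → MvPolynomial (Fin m) ℚ) (e₀ : Fin K → ℚ) (μ : Fin s → KZ.IntegralRep m),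
      (∀ j, ∃ (ν : Fin K → ℤ) (κ : ℚ), KZ.IsMellinMemberWith g (fun k => e₀ k + (ν k : ℚ)) κ (μ j)) →
      (∀ c : Fin s → ℤ, ∑ j, c j • KZ.of (μ j) ∈ KZ.relations → ∀ j, c j = 0) →
      (∀ (r : KZ.IntegralRep m) (ν : Fin K → ℤ) (κ : ℚ),
        KZ.IsMellinMemberWith g (fun k => e₀ k + (ν k : ℚ)) κ r →
        ∃ N : ℕ, N ≠ 0 ∧ ∃ b : Fin s → ℤ,
          (N : ℤ) • KZ.of r - ∑ j, b j • KZ.of (μ j) ∈ KZ.relations) →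
      LinearIndependent ℚ (fun j => (μ j).value)) :
    ∀ (m K L : ℕ) (g : Fin K → MvPolynomial (Fin m) ℚ) (e₀ : Fin K → ℚ) (ν : Fin L → Fin K → ℤ) (κ : Fin L → ℚ) (a : Fin L → ℤ) (r : Fin L → Literature.NumberTheory.Transcendental.KZ.IntegralRep m), (∀ i, (r i).domain = {x | (∀ j, x j ∈ Set.Ioo (0:ℝ) 1) ∧ ∀ k, 0 < MvPolynomial.aeval x (g k)} ∧ Set.EqOn (r i).integrand (fun x => (κ i : ℝ) * ∏ k, (MvPolynomial.aeval x (g k)) ^ ((e₀ k + (ν i k : ℚ) : ℚ) : ℝ)) (r i).domain) → Literature.NumberTheory.Transcendental.KZ.eval (∑ i, a i • Literature.NumberTheory.Transcendental.KZ.of (r i)) = 0 → (∑ i, a i • Literature.NumberTheory.Transcendental.KZ.of (r i)) ∈ Literature.NumberTheory.Transcendental.KZ.relations := by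
  intro m K L g e₀ ν κ a r hr heval
  obtain ⟨s, μ, hμmem, hμind, hμgen⟩ := hB m K g e₀
  have hli : LinearIndependent ℚ (fun j => (μ j).value) := hR m K s g e₀ μ hμmem hμind hμgen
  -- every `r i` is a member of the fibre `(g, e₀)` (token for token the crux hypothesis)
  have hri : ∀ i, KZ.IsMellinMemberWith g (fun k => e₀ k + (ν i k : ℚ)) (κ i) (r i) := fun i => hr i
  choose N hN b hb using fun i => hμgen (r i) (ν i) (κ i) (hri i)
  obtain ⟨d, hd⟩ :=
    exists_nsmul_sum_sub_sum_mem KZ.relations (fun i => KZ.of (r i)) (fun j => KZ.of (μ j)) a N b hb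
  have hP : (∏ i, N i) ≠ 0 := Finset.prod_ne_zero_iff.mpr fun i _ => hN i
  -- soundness: the basis combination has value 0
  have hev : KZ.eval (∑ j, d j • KZ.of (μ j)) = 0 := by
    have h1 : KZ.eval (((∏ i, N i : ℕ) : ℤ) • (∑ i, a i • KZ.of (r i)) - ∑ j, d j • KZ.of (μ j)) = 0 :=
      KZ.relations_le_ker_eval_holds hd
    rw [map_sub, map_zsmul, heval, smul_zero, zero_sub, neg_eq_zero] at h1
    exact h1
  have hsum : ∑ j, (d j : ℚ) • (μ j).value = 0 := by
    have h2 : KZ.eval (∑ j, d j • KZ.of (μ j)) = ∑ j, (d j : ℚ) • (μ j).value := by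
      rw [map_sum]
      refine Finset.sum_congr rfl fun j _ => ?_
      rw [map_zsmul, KZ.eval_of, Int.cast_smul_eq_zsmul]
    rw [← h2]
    exact hev
  -- rigidity: the coefficients vanish
  have hd0 : ∀ j, d j = 0 := by
    have h3 := Fintype.linearIndependent_iff.mp hli (fun j => (d j : ℚ)) hsum
    intro j
    exact_mod_cast h3 j
  have hzero : ∑ j, d j • KZ.of (μ j) = 0 :=
    Finset.sum_eq_zero fun j _ => by simp [hd0 j]
  rw [hzero, sub_zero, Nat.cast_smul_eq_nsmul] at hd
  -- torsion-freeness divides the common denominator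
  exact Summit.KontsevichZagierPeriods.MzvKernelInKZ.Negative.mem_relations_of_nsmul_mem
    (Nat.pos_of_ne_zero hP) hd

/-- **The skeleton theorem** (concludes the crux BY NAME; sorries enter only through the two named
stubs): `CosetKernel` from MASTER BASIS and BASIS RIGIDITY. [cite: KontsevichZagier2001, §1.2 Conjecture 1] -/
theorem CosetKernel_of : CosetKernel :=
  cosetKernel_of_stubs stub_masterBasis stub_basisRigidity

end Summit.KontsevichZagierPeriods.KontsevichZagierPeriods.Cruxes.CosetKernel.Birth

end
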